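import Summits.CriticalPhenomena.PercolationContinuityZ3.Theorems.SahiMasterFamilyTopCoeffAll
import Summits.CriticalPhenomena.PercolationContinuityZ3.Theorems.SahiMasterFamilySharedCoordinatePoly

/-!
# Expectation rigidity under product measures: identities valid for EVERY `p` are structural (arbitrary real functions)

Support file of the master-family programme (crux `NoHeavyLowerTail`, stmt-CriticalPhenomena-4575; cell `prim-masterthm`, seat P4,
unit `prim-masterthm-p4-g7`).  Seat document HOME/prim-masterthm-p4/EQI3-RIGIDITY-PROOF.md §0 (Facts 0 and 1 of the rigidity proof R₃).

Two elementary facts about expectations `E_p(h)` of REAL functions `h : 2^ι → ℝ` under the product weights `μ_p`, `p` in the open cube, using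
prim-master-conj's expectation polynomial `exPoly h ∈ ℝ[X_ι]` (`eval_exPoly`, `degreeOf_exPoly_le`) and the Combinatorial Nullstellensatz grid
(`gridPts`, Mathlib `eq_zero_of_eval_zero_at_prod_finset`):

* `eval_exPoly_vtx` — at the 0/1 VERTEX of `ω` the expectation polynomial evaluates to `h(ω)`;
* **`eq_of_forall_interior_ex_eq`** (FACT 0: polynomials see functions) — if `E_p(f) = E_p(g)` for every interior `p` then `f = g`;
* **`ignores_or_ignores_of_forall_interior_ex_mul_eq`** (FACT 1: independence rigidity) — if `E_p(f g) = E_p(f) E_p(g)` for every interior `p`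
  then every coordinate `y` is inessential for `f` or for `g` (no coordinate is essential for both): the product of the two expectation polynomials
  has `X_y`-degree `deg_y E(f) + deg_y E(g)` (Mathlib `degreeOf_mul_eq`, `ℝ[X]` a domain) but equals `E(fg)` of `X_y`-degree `≤ 1`.
  (For INCREASING events at ONE interior `p` this is the tree's strict Harris `disjoint_determinedBy_of_real_inter_eq`; here the functions are
  arbitrary and the identity is required for all `p`.)
HONEST FRAMING: infrastructure (no statement about Sahi positivity); `C_k`, Kahn's Conj. 5 and the master theorem remain OPEN.  [this work]
-/

noncomputable section

open scoped Classical

namespace Summit.CriticalPhenomena.PercolationContinuityZ3.Theorems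

open Finset Function MvPolynomial
open Literature.Combinatorics.Sahi2008
open Literature.Probability.Percolation.BHK2006 (weight)
open SharedCoordinate (Ignores)

namespace ExpectationRigidity

variable {ι : Type*} [Fintype ι]

/-! ### Vertex evaluation -/

/-- The 0/1 parameter vector of the configuration `ω`. [this work] -/
def vtx (ω : Set ι) : ι → ℝ := fun e => if e ∈ ω then 1 else 0

/-- At the vertex of `ω` the product weight is the point mass at `ω`. [this work] -/
theorem weight_vtx (ω ω' : Set ι) : weight (vtx ω) ω' = if ω' = ω then 1 else 0 := by
  unfold weight vtx
  by_cases h : ω' = ω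
  · subst h
    rw [if_pos rfl]
    exact prod_eq_one fun e _ => by by_cases he : e ∈ ω' <;> simp [he]
  · rw [if_neg h]
    obtain ⟨e, he⟩ : ∃ e, ¬ (e ∈ ω' ↔ e ∈ ω) := by
      by_contra hall
      push Not at hall
      exact h (Set.ext hall)
    refine prod_eq_zero (mem_univ e) ?_
    by_cases h1 : e ∈ ω' <;> by_cases h2 : e ∈ ω <;> simp_all

/-- `E_{vtx ω}(h) = h(ω)`. [this work] -/
theorem ex_weight_vtx (ω : Set ι) (h : Set ι → ℝ) : ex (weight (vtx ω)) h = h ω := by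
  rw [ex]
  simp_rw [weight_vtx]
  simp

/-- **The expectation polynomial at the vertex of `ω` is `h(ω)`.** [this work] -/
theorem eval_exPoly_vtx (ω : Set ι) (h : Set ι → ℝ) : eval (vtx ω) (exPoly h) = h ω := by
  rw [eval_exPoly, ex_weight_vtx]

/-! ### Fact 0: identities of expectations valid on the open cube are identities of functions -/

/-- Interior grid points as points of the unit interval (plumbing). [this work] -/
theorem ex_weight_eq_of_grid {n : ℕ} {x : ι → ℝ} (hx : ∀ e, x e ∈ gridPts n) (h : Set ι → ℝ) :
    ex (weight x) h = ex (bernoulliWeight fun e => (⟨x e, (mem_Ioo_of_mem_gridPts (hx e)).1.le, (mem_Ioo_of_mem_gridPts (hx e)).2.le⟩ : unitInterval)) h :=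
  rfl

/-- **If `E_p(f) = E_p(g)` for every interior `p` then `exPoly f = exPoly g`.** [this work] -/
theorem exPoly_eq_of_forall_interior {f g : Set ι → ℝ}
    (h : ∀ p : ι → unitInterval, (∀ e, (p e : ℝ) ∈ Set.Ioo (0 : ℝ) 1) → ex (bernoulliWeight p) f = ex (bernoulliWeight p) g) :
    exPoly f = exPoly g := by
  refine sub_eq_zero.1 (eq_zero_of_eval_zero_at_prod_finset _ (fun _ => gridPts 1) (fun e => ?_) fun x hx => ?_)
  · refine (degreeOf_sub_le e _ _).trans_lt ?_
    rw [card_gridPts]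
    exact (max_le (degreeOf_exPoly_le f e) (degreeOf_exPoly_le g e)).trans_lt (by norm_num)
  · rw [map_sub, eval_exPoly, eval_exPoly, sub_eq_zero, ex_weight_eq_of_grid hx, ex_weight_eq_of_grid hx]
    exact h _ fun e => mem_Ioo_of_mem_gridPts (hx e)

/-- **FACT 0 (polynomials see functions).**  If `E_p(f) = E_p(g)` for every interior `p` then `f = g`. [this work] -/
theorem eq_of_forall_interior_ex_eq {f g : Set ι → ℝ}
    (h : ∀ p : ι → unitInterval, (∀ e, (p e : ℝ) ∈ Set.Ioo (0 : ℝ) 1) → ex (bernoulliWeight p) f = ex (bernoulliWeight p) g) : f = g := by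
  funext ω
  have := congrArg (MvPolynomial.eval (vtx ω)) (exPoly_eq_of_forall_interior h)
  rwa [eval_exPoly_vtx, eval_exPoly_vtx] at this

/-! ### Fact 1: uncorrelated under every product measure ⇒ no coordinate is essential for both -/

/-- **If `E_p(fg) = E_p(f)E_p(g)` for every interior `p` then `exPoly (f g) = exPoly f · exPoly g`.** [this work] -/
theorem exPoly_mul_eq_of_forall_interior {f g : Set ι → ℝ}
    (h : ∀ p : ι → unitInterval, (∀ e, (p e : ℝ) ∈ Set.Ioo (0 : ℝ) 1) →
      ex (bernoulliWeight p) (f * g) = ex (bernoulliWeight p) f * ex (bernoulliWeight p) g) :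
    exPoly (f * g) = exPoly f * exPoly g := by
  refine sub_eq_zero.1 (eq_zero_of_eval_zero_at_prod_finset _ (fun _ => gridPts 2) (fun e => ?_) fun x hx => ?_)
  · refine (degreeOf_sub_le e _ _).trans_lt ?_
    rw [card_gridPts]
    have h1 : degreeOf e (exPoly (f * g)) ≤ 2 := (degreeOf_exPoly_le _ e).trans (by norm_num)
    have h2 : degreeOf e (exPoly f * exPoly g) ≤ 2 :=
      (degreeOf_mul_le e _ _).trans (Nat.add_le_add (degreeOf_exPoly_le f e) (degreeOf_exPoly_le g e))
    exact (max_le h1 h2).trans_lt (by norm_num)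
  · rw [map_sub, map_mul, eval_exPoly, eval_exPoly, eval_exPoly, sub_eq_zero, ex_weight_eq_of_grid hx, ex_weight_eq_of_grid hx,
      ex_weight_eq_of_grid hx]
    exact h _ fun e => mem_Ioo_of_mem_gridPts (hx e)

omit [Fintype ι] in
/-- A polynomial without the variable `y` has `y`-independent evaluations. [folklore] -/
theorem eval_update_eq_of_degreeOf_eq_zero {P : MvPolynomial ι ℝ} {y : ι} (hP : degreeOf y P = 0) (x : ι → ℝ) (t : ℝ) :
    eval (update x y t) P = eval x P := by
  refine eval₂Hom_congr' rfl (fun i hi _ => ?_) rfl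
  have hiy : i ≠ y := fun h => (mem_vars_iff_degreeOf_ne_zero.1 hi) (h ▸ hP)
  exact update_of_ne hiy _ _

/-- **`deg_y E(f) = 0 ⇒ y` is inessential for `f`.** [this work] -/
theorem ignores_of_degreeOf_exPoly_eq_zero {f : Set ι → ℝ} {y : ι} (h0 : degreeOf y (exPoly f) = 0) : Ignores y f := by
  intro ω
  have h1 : vtx (insert y ω) = update (vtx ω) y 1 := by
    funext e
    by_cases hey : e = y
    · subst hey; simp [vtx]
    · rw [update_of_ne hey]; simp [vtx, hey]
  rw [← eval_exPoly_vtx (insert y ω) f, ← eval_exPoly_vtx ω f, h1, eval_update_eq_of_degreeOf_eq_zero h0]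

/-- A function with vanishing expectation polynomial is zero, hence ignores every coordinate. [this work] -/
theorem ignores_of_exPoly_eq_zero {f : Set ι → ℝ} (h0 : exPoly f = 0) (y : ι) : Ignores y f :=
  ignores_of_degreeOf_exPoly_eq_zero (by rw [h0, degreeOf_zero])

/-- **FACT 1 (independence rigidity).**  If `E_p(f g) = E_p(f) E_p(g)` for every interior `p` (arbitrary real `f, g`), then every coordinate
is inessential for `f` or for `g`. [this work] -/
theorem ignores_or_ignores_of_forall_interior_ex_mul_eq {f g : Set ι → ℝ}
    (h : ∀ p : ι → unitInterval, (∀ e, (p e : ℝ) ∈ Set.Ioo (0 : ℝ) 1) →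
      ex (bernoulliWeight p) (f * g) = ex (bernoulliWeight p) f * ex (bernoulliWeight p) g) (y : ι) :
    Ignores y f ∨ Ignores y g := by
  have hmul := exPoly_mul_eq_of_forall_interior h
  by_cases hf : exPoly f = 0
  · exact Or.inl (ignores_of_exPoly_eq_zero hf y)
  by_cases hg : exPoly g = 0
  · exact Or.inr (ignores_of_exPoly_eq_zero hg y)
  have hdeg : degreeOf y (exPoly f) + degreeOf y (exPoly g) ≤ 1 := by
    rw [← degreeOf_mul_eq hf hg, ← hmul]
    exact degreeOf_exPoly_le _ y
  rcases Nat.eq_zero_or_pos (degreeOf y (exPoly f)) with h0 | h0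
  · exact Or.inl (ignores_of_degreeOf_exPoly_eq_zero h0)
  · exact Or.inr (ignores_of_degreeOf_exPoly_eq_zero (by omega))

end ExpectationRigidity

end Summit.CriticalPhenomena.PercolationContinuityZ3.Theorems
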